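import Summits.BirchSwinnertonDyer.BirchSwinnertonDyer.Theses.PrintCf2
import Summits.BirchSwinnertonDyer.BirchSwinnertonDyer.Theorems.PrintCf2MaximalOrderReduction
import HarnessLib

/-!
# Route PrintCf2 — glue item `InertTwoRankOneOfFactsGlue` (stmt-BirchSwinnertonDyer-20673) CLOSED

Cell `bsd-print-cf2` (D-0131 (2) PRINT TIER, leaf CornerF @ `p = 2`), prover p3. The layer-2 split of the
inert crux `InertTwoRankOneOfFacts` (stmt-BirchSwinnertonDyer-20363) in `j`-currency: the two children
`InertJZeroOfFacts` (`j = 0`) and `InertOddHeegnerJOfFacts` (the five odd-Heegner `j`-invariants) give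
back the parent, granted the conjuncts Cassels / GZK / modularity of 𝔅_inert, by p4's PROVED bridge
`Theorems.PrintCf2.wAllCornerFTwoInert_iff_maximal` (p540203: the inert class statement ⟺ its
maximal-order `j`-form). Pure bookkeeping; beyond-print: n/a. [cite: MilneADT2006, Thm. I.7.3]
-/

-- single-conjunct summit: `Summit.BirchSwinnertonDyer.BirchSwinnertonDyer.…` repeats the name by design
set_option linter.dupNamespace false

namespace Summit.BirchSwinnertonDyer.BirchSwinnertonDyer.Theorems

open Summit.BirchSwinnertonDyer.BirchSwinnertonDyer.Theses.PrintCf2 in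
/-- **Item `InertTwoRankOneOfFactsGlue` (stmt-BirchSwinnertonDyer-20673) holds**:
`InertJZeroOfFacts → InertOddHeegnerJOfFacts → InertTwoRankOneOfFacts`, by
`(wAllCornerFTwoInert_iff_maximal hCAS hGZK hMOD).mpr` applied to the disjunction `j = 0 ∨ j ∈ {odd Heegner}`.
[cite: MilneADT2006, Thm. I.7.3] -/
theorem inertTwoRankOneOfFactsGlue_proof :
    Summit.BirchSwinnertonDyer.BirchSwinnertonDyer.Theses.PrintCf2.InertTwoRankOneOfFactsGlue := by
  unfold InertTwoRankOneOfFactsGlue InertTwoRankOneOfFacts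
  intro hJ hO hB
  have hGZK := hB.1
  have hMOD := hB.2.1
  have hCAS := hB.2.2.1
  exact (Summit.BirchSwinnertonDyer.BirchSwinnertonDyer.Theorems.PrintCf2.wAllCornerFTwoInert_iff_maximal
    hCAS hGZK hMOD).mpr fun W _ _ hr hj => hj.elim (hJ hB W hr) (hO hB W hr)

end Summit.BirchSwinnertonDyer.BirchSwinnertonDyer.Theorems
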